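import Literature.MathematicalPhysics.QuantumLattice.GaugeGroups
import Literature.Analysis.OperatorTheory.YangMillsMatrixModelDiscreteSpectrum
import HarnessLib

/-!
# The femto-universe gap of lattice `SU(2)` Yang–Mills in TRANSFER-OPERATOR currency — rung R2b′ of LADDER-YM
# (`FemtoGapOfRecord`, `FemtoGapFixedLattice`, `FemtoGapOneSite`: OPEN leaves, D-0061; seams proved)

Leaf module of cell `ym-beyond`, seat P1 «RG into the infrared» (memo of record `run/shared/lean/pub/ym-beyond/ROUTE-P1.md`
§14, §17–§18), answering director-ym LINE №8 (d): «land ONE closed instance of record of the small-volume dynamical (femto) gap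
as a D-0061 leaf (closed `Prop`, fully-qualified name)».  The tree's `FemtoFamily.FemtoGap S ε₁ C`
(`Literature/…/Balaban1983to89/FemtoUniverseGap.lean`) is parametrised by an abstract CARRIER `Φ : FemtoFamily` (transfer data not
tied to any lattice theory; `not_gapRate_trivialFamily` shows an arbitrary carrier has no gap), so no choice of numbers closes it.  This
module supplies the carrier: the zero-flux spatial TRANSFER KERNEL of Wilson's lattice gauge theory on the three-torus `(ℤ/L)³`, and
states the femto gap about IT, in lattice units, with no unit map and no guard hypothesis.

## Contents
* §1 (any compact `G`, any matrix representation `ρ`).  The spatial transfer kernel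
  `K_β(U,V) = exp(β ∑ₑ Re tr ρ(Uₑ Vₑ⁻¹) − (β/2)(S(U) + S(V)))` on `GaugeConfig 3 L G` (temporal gauge; `S` = the tree's `wilsonAction`
  on the spatial torus; the constant `e^{-β N |E|}` of the usual time-like plaquette cost is dropped — it cancels in every ratio below);
  the CENTRE TWISTS `twist k z` (`z ∈ Z(G)`, all links in direction `k` through the plane `x_k = 0`); the PHYSICAL ZERO-FLUX test
  functions `IsPhys` (bounded, measurable, gauge-invariant, twist-invariant = 't Hooft electric flux `e = 0`); the variational TOP
  VALUE `topValue` (`λ₀ = sup` of Rayleigh quotients `⟨ψ,Kψ⟩/⟨ψ,ψ⟩` over `IsPhys`) and SECOND VALUE `secondValue`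
  (`λ₁ = inf_φ sup_{ψ ⊥ φ}`, min–max); the energy of the first zero-flux excitation per lattice time step is `E = −log(λ₁/λ₀)` and the
  femto variable is `z = L·E`; all gap statements below are written multiplicatively, `λ₁ ≤ e^{−z_*/L} λ₀`, so no logarithm of a junk
  value occurs.  Proved: `transferKernel_pos`, `isPhys_const`, `topValue_nonneg`.
* §2 (`SU(2)` numbers).  `b0 = 11/(24π²)`, `b1 = 17/(96π⁴)` (the one- and two-loop coefficients at `N = 2`); the two-loop asymptotic-scaling SIZE
  LABEL `sizeLog β L = log L − β/(4 b0) − (b1/(2 b0²)) log(2 b0/β)` (= `log(ℓ Λ_L) + O(1/β)`, `ℓ = L a(β)`, bare `g₀² = 2/β` in the tree's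
  normalisation `β = β_Wilson/N`; exponent `b1/(2 b0²) = 51/121`); the running inverse coupling at the box scale
  `invRunningCoupling = −2 b0 · sizeLog` (one loop in the label: `ḡ²(ℓ) = 12π²/(−11 log(ℓΛ))`); Lüscher's expansion parameter
  `luscherLambda = ḡ^{2/3} = (max invRunningCoupling 0)^{−1/3}` (`= 0` off the asymptotically free side, so a window `0 < lam ≤ λ` is never
  met by a junk value); the femto WINDOW `InFemtoWindow lam β L : 1 ≤ β ∧ lam ≤ λ(β,L) ≤ 2 lam`.
* §3 The leaves (all `@[conjecture]`, OPEN, not claimed) and the proved seams: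
  `FemtoGapOfRecord` — **the rung of record R2b′**: `∃ C λ₀ > 0, ∀ lam ∈ (0, λ₀], ∃ L₀, ∀ L ≥ L₀, ∀ β` in the window,
  `λ₁(β,L) ≤ exp(−(ε₁ λ − C λ²)/L) λ₀(β,L)`, i.e. `z(β,L) ≥ ε₁ λ(β,L) − C λ(β,L)²` uniformly along two-loop scaling trajectories deep in
  the femto regime, with `ε₁ = Literature.Analysis.OperatorTheory.YMMatrixModel.luscherEps1` BY NAME (the first excitation of Lüscher's
  lowest-order zero-momentum Hamiltonian `𝔥 = −½Δ + ¼Σ|x_i × x_j|²` in the colour-invariant sector; no numerical value asserted);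
  `FemtoGapSU2` — its qualitative shadow (`z ≥ c(lam) > 0`); `femtoGapSU2_of_ofRecord : LuscherSimonGap → FemtoGapOfRecord → FemtoGapSU2`
  (PROVED); `FemtoGapFixedLattice` — the fixed-lattice semiclassical law (`∀ L, z(β,L) ≥ ε₁ (2/β)^{1/3} − C_L (2/β)^{2/3}` for
  `β ≥ β_L`; finite-dimensional: `3L³` compact-group degrees of freedom) and its one-site instance `FemtoGapOneSite` (`L = 1`: three `SU(2)`
  links, plaquette = group commutator — a three-matrix model whose `β → ∞` transfer spectrum should be `e^{−(2/β)^{1/3} 𝔥}` to leading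
  order: the CHEAPEST FALSIFIER of every normalisation used here); `femtoGapOneSite_of_fixedLattice` (PROVED, specialisation).

## Why these choices (the typing decisions, for the auditor)
* TRANSFER currency, not clustering currency: at femto scale the torus two-point clustering rate carries no information (`E·t ≤ O(g^{2/3})`),
  whereas `λ₁/λ₀` of the zero-flux transfer operator is exactly Lüscher's object [Luscher1983]; physical Hilbert space = gauge-
  invariant wave functions of the spatial links, transfer matrix = the kernel operator restricted to them [SeilerLNP1982, §2–§3].
* ZERO FLUX is essential: without twist-invariance the first excitation is a torelon (`e ≠ 0` copy of the vacuum) of energy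
  `2L⁻¹ λ_B B² g^{5/3} exp(−S/g + …)` [Vanbaal2001, arXiv p. 7], exponentially below `ε₁ g^{2/3}/L`, and the `λ`-law would be false.  ALL cubic /
  parity channels are kept: `luscherEps1 = physLevel 2 − physLevel 1` is the first excitation over all colour-invariant states, which in
  very small volumes is the tensor `2⁺` (`E⁺`, `T₂⁺`), lighter than the scalar `A₁⁺` [Vanbaal2001, arXiv p. 9] («in weak coupling the
  smallest mass is a 2⁺ state» [KollerVanbaal1986, p. 400]); for comparison the scalar's lowest-order law is `M(0⁺)·L = 2.2696390 ḡ^{2/3}`,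
  `2.2696390 = 6.3863588 − 4.116719735` = first excited minus ground `A₁⁺` level of `𝔥` [KollerVanbaal1986, eqs. (29), (30), (32),
  pp. 396–397]; `secondValue` sees exactly the lowest excitation, whichever channel.  Non-zero momenta cost `z = O(2π)` [Vanbaal2001, arXiv p. 9].
* TWO LOOPS IN THE LABEL, one loop in the coupling: the label must pin the physical size `ℓΛ_L` up to `o(1)` as `L → ∞` (at fixed ONE-loop
  label `β/2 − 2 b0 log L` the size drifts like `(51/121) log β → ∞` and the window would leave the femto regime — the statement would then
  secretly contain the large-volume gap); given the label, replacing the one-loop `ḡ` by any two-loop / other-scheme coupling (lattice `Λ_L`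
  vs `Λ_MS`: [HasenfratzHasenfratz1980], [DashenGross1981]) changes `λ = ḡ^{2/3}` by `O(λ⁴ log λ)`, inside the `C λ²` slack; so `C`, `λ₀`
  existential and `ε₁` by name make the leaf scheme-robust.  Expansion `z = ε₁λ + ε₂λ² + …`, `λ = ḡ(ℓ)^{2/3}`: [LuscherMunster1984].
* NO UNIT MAP, NO GUARD: `z = E_lat · L` and `λ(β, L)` are pure lattice quantities, so the leaf is not vacuous-through-a-guard and needs no
  `LowerBounds`-type hypothesis (contrast the spine's `GapInUnits`).

## WHAT THIS IS NOT
Not the Clay mass gap, not uniform in the volume in physical units (the window shrinks the box as `lam → 0`), not a continuum limit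
statement about Schwinger functions, and NOT YET LINKED to the spine's currency: the identification «transfer-operator gap of the Wilson
theory = spectral gap of the OS-reconstructed Hamiltonian of the time-periodic lattice state» (Osterwalder–Seiler) is the spine's definition
request `FemtoRealisation` (route `BalabanLadder`, NOT DECOMPOSED YET) and is not made here.  The leaves quantify over honest lattice
objects only; every docstring tagged `[status: open]` is a conjecture of record, registered as a RUNG LEAF (never summit credit).
-/

set_option autoImplicit false

noncomputable section

open MeasureTheory Filter Topology Real
open Literature.MathematicalPhysics.QuantumFieldTheory
open Literature.MathematicalPhysics.QuantumLattice
open Literature.Analysis.OperatorTheory.YMMatrixModel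

namespace Summit.QuantumFields.YangMills.Theorems.FemtoTransferGap

/-! ### §1. The zero-flux spatial transfer kernel and its two top variational values -/

section Algebra

variable {N : ℕ} {G : Type*} [Group G] (ρ : G →* Matrix (Fin N) (Fin N) ℂ)

/-- The time-like coupling `∑ₑ Re tr ρ(Uₑ Vₑ⁻¹)` between consecutive time slices `U`, `V` in temporal gauge (the time-like plaquette
through the edge `e` has holonomy `Uₑ Vₑ⁻¹` when the time-like links are gauged to `1`). [cite: SeilerLNP1982, §3] -/
def timeCoupling {L : ℕ} [NeZero L] (U V : GaugeConfig 3 L G) : ℝ :=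
  ∑ e : Edge 3 L, ((ρ (U e * (V e)⁻¹)).trace).re

/-- **The spatial transfer kernel** `K_β(U,V) = exp(β ∑ₑ Re tr ρ(UₑVₑ⁻¹) − (β/2)(S(U) + S(V)))`, `S` = the Wilson action of the spatial
three-torus (tree `wilsonAction`, all plaquettes of `(ℤ/L)³`).  Up to the constant factor `exp(−β N |E|)` this is the temporal-gauge
transfer matrix density of Wilson's theory with coupling `β` (tree normalisation `β = β_Wilson / N`, weight `exp(−β S)`); the physical
transfer operator is the kernel operator of `K_β` on `L²(configMeasure)` restricted to gauge-invariant functions.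
[cite: SeilerLNP1982, §3] [cite: Luscher1983] -/
def transferKernel {L : ℕ} [NeZero L] (β : ℝ) (U V : GaugeConfig 3 L G) : ℝ :=
  Real.exp (β * timeCoupling ρ U V - (β / 2) * (wilsonAction ρ U + wilsonAction ρ V))

/-- The transfer kernel is pointwise positive. [folklore] -/
theorem transferKernel_pos {L : ℕ} [NeZero L] (β : ℝ) (U V : GaugeConfig 3 L G) :
    0 < transferKernel ρ β U V :=
  Real.exp_pos _

/-- **Centre twist** through the plane `x_k = 0`: multiply every link in direction `k` issuing from a site with `x_k = 0` by the central
element `z`.  For `z ∈ Z(G)` this is a symmetry of the kernel and of the Wilson action (each spatial plaquette contains zero or two such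
links, with opposite orientation); its characters are 't Hooft's electric fluxes `e_k`. [cite: tHooft1979] [cite: Luscher1983] -/
def twist {L : ℕ} (k : Fin 3) (z : G) (U : GaugeConfig 3 L G) : GaugeConfig 3 L G :=
  fun e => if e.2 = k ∧ e.1 k = 0 then z * U e else U e

/-- Twisting by `1` does nothing. [folklore] -/
@[simp] theorem twist_one {L : ℕ} (k : Fin 3) (U : GaugeConfig 3 L G) : twist k (1 : G) U = U := by
  funext e; simp [twist]

end Algebra

section Sector

variable {G : Type*} [Group G] [MeasurableSpace G]

/-- **Physical zero-flux test functions**: bounded measurable real functions of the spatial links that are invariant under all gauge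
transformations (Gauss law) and under the three centre twists (electric flux `e = 0`).  (Twists through parallel planes differ by a
gauge transformation, so one plane per direction suffices.) [cite: Luscher1983] [cite: tHooft1979] -/
structure IsPhys {L : ℕ} (ψ : GaugeConfig 3 L G → ℝ) : Prop where
  measurable : Measurable ψ
  bounded : ∃ C : ℝ, ∀ U, |ψ U| ≤ C
  gaugeInv : ∀ (g : Site 3 L → G) (U : GaugeConfig 3 L G), ψ (gaugeTransform g U) = ψ U
  zeroFlux : ∀ (k : Fin 3), ∀ z ∈ Subgroup.center G, ∀ U : GaugeConfig 3 L G, ψ (twist k z U) = ψ U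

/-- Constants are physical zero-flux test functions. [folklore] -/
theorem isPhys_const {L : ℕ} (c : ℝ) : IsPhys (G := G) (L := L) (fun _ => c) where
  measurable := measurable_const
  bounded := ⟨|c|, fun _ => le_rfl⟩
  gaugeInv := fun _ _ => rfl
  zeroFlux := fun _ _ _ _ => rfl

end Sector

section Transfer

variable {N : ℕ} {G : Type*} [Group G] [TopologicalSpace G] [IsTopologicalGroup G] [CompactSpace G]
  [MeasurableSpace G] [BorelSpace G]

variable (G) in
/-- The a-priori measure on spatial link configurations of the three-torus `(ℤ/L)³`: product of normalised Haar measures, one per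
positively oriented edge (the tree's `haarProbability`). [cite: SeilerLNP1982, §2] -/
def configMeasure (L : ℕ) [NeZero L] : Measure (GaugeConfig 3 L G) :=
  Measure.pi fun _ : Edge 3 L => haarProbability G

/-- The a-priori measure is a probability measure (finite product of Haar probability measures). [folklore] -/
instance configMeasure.instIsProbabilityMeasure (L : ℕ) [NeZero L] :
    IsProbabilityMeasure (configMeasure G L) := by
  unfold configMeasure; infer_instance

variable (ρ : G →* Matrix (Fin N) (Fin N) ℂ)

/-- The `L²(configMeasure)` pairing `⟨ψ, φ⟩ = ∫ ψ φ`. [folklore] -/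
def l2 {L : ℕ} [NeZero L] (ψ φ : GaugeConfig 3 L G → ℝ) : ℝ :=
  ∫ U, ψ U * φ U ∂(configMeasure G L)

/-- The transfer quadratic form `⟨ψ, K_β φ⟩ = ∫∫ ψ(U) K_β(U,V) φ(V) dU dV`. [cite: SeilerLNP1982, §3] -/
def qform {L : ℕ} [NeZero L] (β : ℝ) (ψ φ : GaugeConfig 3 L G → ℝ) : ℝ :=
  ∫ U, ∫ V, ψ U * transferKernel ρ β U V * φ V ∂(configMeasure G L) ∂(configMeasure G L)

/-- The set of Rayleigh quotients `⟨ψ,K_βψ⟩/⟨ψ,ψ⟩` of physical zero-flux test functions `ψ ≠ 0` satisfying an extra constraint `P`.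
[cite: ReedSimonIV1978, Thm. XIII.1] -/
def rayleighSet (L : ℕ) [NeZero L] (β : ℝ) (P : (GaugeConfig 3 L G → ℝ) → Prop) : Set ℝ :=
  {r | ∃ ψ : GaugeConfig 3 L G → ℝ, IsPhys ψ ∧ P ψ ∧ 0 < l2 ψ ψ ∧ r = qform ρ β ψ ψ / l2 ψ ψ}

/-- **Top value `λ₀(β, L)`**: the supremum of the Rayleigh quotient of `K_β` over physical zero-flux test functions — the top of the
spectrum (= norm; the Perron–Frobenius eigenvalue, whose eigenfunction is positive, hence gauge- and twist-invariant) of the zero-flux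
transfer operator. [cite: ReedSimonIV1978, Thm. XIII.1] [cite: Luscher1983] -/
def topValue (L : ℕ) [NeZero L] (β : ℝ) : ℝ :=
  sSup (rayleighSet ρ L β fun _ => True)

/-- **Second value `λ₁(β, L)`** (min–max): `inf` over physical `φ` of the `sup` of Rayleigh quotients over physical `ψ ⊥ φ` — the second
eigenvalue, with multiplicity, of the zero-flux transfer operator (`φ` = the ground state realises the infimum).  The energy of the first
zero-flux excitation per lattice time step is `−log(λ₁/λ₀)`. [cite: ReedSimonIV1978, Thm. XIII.1] [cite: LuscherMunster1984] -/
def secondValue (L : ℕ) [NeZero L] (β : ℝ) : ℝ :=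
  sInf {s | ∃ φ : GaugeConfig 3 L G → ℝ, IsPhys φ ∧ s = sSup (rayleighSet ρ L β fun ψ => l2 ψ φ = 0)}

/-- The top value is non-negative: either the Rayleigh set is unbounded (junk `sSup = 0`) or it contains the quotient of the constant
function `1`, which is `∫∫ K_β ≥ 0`. [folklore] -/
theorem topValue_nonneg (L : ℕ) [NeZero L] (β : ℝ) : 0 ≤ topValue ρ L β := by
  unfold topValue
  set S := rayleighSet ρ L β fun _ => True with hS
  by_cases hb : BddAbove S
  · have hl2 : l2 (G := G) (L := L) (fun _ => (1 : ℝ)) (fun _ => 1) = 1 := by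
      simp [l2]
    have hq : 0 ≤ qform ρ β (L := L) (fun _ => (1 : ℝ)) (fun _ => 1) := by
      unfold qform
      exact integral_nonneg fun U => integral_nonneg fun V => by
        have := transferKernel_pos ρ β U V
        positivity
    have hmem : qform ρ β (L := L) (fun _ => (1 : ℝ)) (fun _ => 1) / 1 ∈ S := by
      refine ⟨fun _ => 1, isPhys_const 1, trivial, by rw [hl2]; exact one_pos, by rw [hl2]⟩
    exact le_trans (by rw [div_one]; exact hq) (le_csSup hb hmem)
  · rw [Real.sSup_of_not_bddAbove hb]

end Transfer

/-! ### §2. `SU(2)`: coefficients, the two-loop size label, the running coupling and the femto window -/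

/-- One-loop coefficient `b₀ = 11N/(48π²)` at `N = 2`. [cite: LuscherMunster1984] -/
def b0 : ℝ := 11 / (24 * π ^ 2)

/-- Two-loop coefficient `b₁ = 34N²/(3(16π²)²)` at `N = 2` (so `b₁/(2b₀²) = 51/121`). [cite: HasenfratzHasenfratz1980, p. 165] -/
def b1 : ℝ := 17 / (96 * π ^ 4)

/-- **Two-loop asymptotic-scaling size label** `log L − β/(4b₀) − (b₁/(2b₀²)) log(2b₀/β)`: with bare coupling `g₀² = 2/β` this is
`log(L · a(β) Λ_L) + O(g₀²)`, `a Λ_L = exp(−1/(2b₀g₀²)) (b₀g₀²)^{−b₁/(2b₀²)} (1 + O(g₀²))`, i.e. the logarithm of the physical box size in units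
of the lattice `Λ`-parameter. [cite: HasenfratzHasenfratz1980, pp. 165–166] [cite: DashenGross1981, §I–II] -/
def sizeLog (β : ℝ) (L : ℕ) : ℝ :=
  Real.log L - β / (4 * b0) - (b1 / (2 * b0 ^ 2)) * Real.log (2 * b0 / β)

/-- The (one-loop, lattice-`Λ`) **running inverse coupling at the box scale**, `1/ḡ²(ℓ) = −2b₀ log(ℓΛ_L)`
(`ḡ² = 12π²/(−11 log(ℓΛ))` for `SU(2)`). [cite: Vanbaal2001, arXiv p. 7] [cite: Luscher1983] -/
def invRunningCoupling (β : ℝ) (L : ℕ) : ℝ := -2 * b0 * sizeLog β L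

/-- **Lüscher's expansion parameter** `λ = ḡ(ℓ)^{2/3} = (1/ḡ²)^{−1/3}`; set to the junk value `0` where `1/ḡ² ≤ 0` (outside the
asymptotically free side), so that `0 < lam ≤ λ` always certifies a genuine weak running coupling. [cite: LuscherMunster1984] -/
def luscherLambda (β : ℝ) (L : ℕ) : ℝ := (max (invRunningCoupling β L) 0) ^ (-(1 : ℝ) / 3)

/-- **The femto window at level `lam`**: weak bare coupling (`β ≥ 1`, excluding the strong-coupling branch of the label) and running
parameter `λ(β, L) ∈ [lam, 2·lam]`. [cite: LuscherMunster1984] -/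
def InFemtoWindow (lam β : ℝ) (L : ℕ) : Prop :=
  1 ≤ β ∧ lam ≤ luscherLambda β L ∧ luscherLambda β L ≤ 2 * lam

/-- Lüscher's **bare** expansion parameter at fixed lattice size, `λ_bare = g₀^{2/3} = (2/β)^{1/3}`. [cite: Luscher1983] -/
def bareLambda (β : ℝ) : ℝ := (2 / β) ^ ((1 : ℝ) / 3)

/-! ### §3. The leaves (OPEN, `@[conjecture]`) and the proved seams -/

/-- The gauge group `SU(2)` of the leaves. [folklore] -/
abbrev SU2 : Type := Matrix.specialUnitaryGroup (Fin 2) ℂ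

/-- Its fundamental representation (tree `fundamentalRep`), the `ρ` of the Wilson action with `N = 2`. [cite: BrockerTomDieck1985, I (1.10)] -/
abbrev su2Rep : SU2 →* Matrix (Fin 2) (Fin 2) ℂ := fundamentalRep (Fin 2)

/-- Lüscher's lower law for the femto variable: `z_*(C; β, L) = ε₁ λ(β,L) − C λ(β,L)²`, `ε₁ = luscherEps1` by name. [cite: LuscherMunster1984] -/
def zLower (C β : ℝ) (L : ℕ) : ℝ :=
  luscherEps1 * luscherLambda β L - C * luscherLambda β L ^ 2

/-- **LEAF `FemtoGapOfRecord` — rung R2b′ of LADDER-YM («small-volume dynamical gap», transfer currency, `SU(2)`).**  There are `C` and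
`λ₀ > 0` such that for every level `0 < lam ≤ λ₀`, for all sufficiently fine lattices `L ≥ L₀(lam)` and every coupling `β` in the femto
window `λ(β, L) ∈ [lam, 2 lam]` (two-loop scaling label), the zero-flux transfer operator of `SU(2)` Wilson theory on `(ℤ/L)³` satisfies
`λ₁ ≤ exp(−(ε₁λ − Cλ²)/L) · λ₀`, i.e. its first zero-flux excitation energy obeys `L · E(β, L) ≥ ε₁ λ − C λ²` — Lüscher's law
`E = (ε₁ ḡ^{2/3} + O(ḡ^{4/3}))/L` as a one-sided bound holding uniformly on the approach to the continuum in a box DEEP INSIDE the femto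
regime.  `ε₁ = luscherEps1` (first excitation of `𝔥 = −½Δ + ¼Σ|x_i × x_j|²` over colour-invariant states; numerically the tensor level,
not asserted).  OPEN: Lüscher's expansion is derived in renormalised perturbation theory (Bloch) [Luscher1983], [LuscherMunster1984];
no non-perturbative (constructive) control of the small-volume continuum limit of the lattice transfer spectrum is in print — this is what a
Bałaban-type small-field analysis in FINITE physical volume would have to deliver.  NOT THE CLAY GAP.
[cite: Luscher1983] [cite: LuscherMunster1984] [cite: Vanbaal2001, arXiv pp. 7, 9] [status: open] -/
@[conjecture] def FemtoGapOfRecord : Prop :=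
  ∃ C lam0 : ℝ, 0 < lam0 ∧ ∀ lam : ℝ, 0 < lam → lam ≤ lam0 →
    ∃ L0 : ℕ, ∀ (L : ℕ) [NeZero L], L0 ≤ L → ∀ β : ℝ, InFemtoWindow lam β L →
      secondValue su2Rep L β ≤ Real.exp (-(zLower C β L) / L) * topValue su2Rep L β

/-- **LEAF `FemtoGapSU2` — the qualitative femto gap** (shadow of `FemtoGapOfRecord`): for every small level `lam` there is `c > 0` with
`λ₁ ≤ e^{−c/L} λ₀`, i.e. `L·E(β,L) ≥ c`, eventually in `L`, throughout the window.  OPEN; implied by `FemtoGapOfRecord` given the tree's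
named fact `LuscherSimonGap` (`0 < ε₁`): `femtoGapSU2_of_ofRecord`. [cite: Luscher1983] [status: open] -/
@[conjecture] def FemtoGapSU2 : Prop :=
  ∃ lam0 : ℝ, 0 < lam0 ∧ ∀ lam : ℝ, 0 < lam → lam ≤ lam0 →
    ∃ c : ℝ, 0 < c ∧ ∃ L0 : ℕ, ∀ (L : ℕ) [NeZero L], L0 ≤ L → ∀ β : ℝ, InFemtoWindow lam β L →
      secondValue su2Rep L β ≤ Real.exp (-c / L) * topValue su2Rep L β

/-- **LEAF `FemtoGapFixedLattice` — the fixed-lattice semiclassical Lüscher law.**  On every FIXED spatial lattice `(ℤ/L)³` the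
zero-flux transfer operator of `SU(2)` Wilson theory obeys, as `β → ∞`, `λ₁ ≤ exp(−(ε₁ λ_b − C_L λ_b²)/L) λ₀` with the BARE parameter
`λ_b = (2/β)^{1/3} = g₀^{2/3}`: at fixed `L` the non-constant modes are stiff (`O(β)`), the low spectrum is that of the zero-momentum
quartic modes near the torons, `L·H_eff = g₀^{2/3} 𝔥 (1 + O_L(g₀^{2/3}))`, and the zero-flux projection removes the exponentially
split toron copies.  A statement about a compact-group quantum mechanics with `3L³` degrees of freedom (finite-dimensional semiclassics
with a degenerate critical manifold); OPEN as stated (no proof in print), strictly below `FemtoGapOfRecord` in reach (non-uniform in `L`).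
[cite: Luscher1983] [cite: SimonB1983DiscreteSpectrum, Cor. 4 p. 217] [status: open] -/
@[conjecture] def FemtoGapFixedLattice : Prop :=
  ∀ (L : ℕ) [NeZero L], ∃ C β0 : ℝ, ∀ β : ℝ, β0 ≤ β →
    secondValue su2Rep L β ≤
      Real.exp (-(luscherEps1 * bareLambda β - C * bareLambda β ^ 2) / L) * topValue su2Rep L β

/-- **LEAF `FemtoGapOneSite` — the one-site three-matrix model (`L = 1`).**  Three `SU(2)` link matrices `U₁, U₂, U₃`, plaquette
holonomies = group commutators, kernel `exp(β Σ_k Re tr(U_k V_k⁻¹) − (β/2)(S(U)+S(V)))`, `S(U) = Σ_{k<l} (2 − Re tr[U_k, U_l])`; zero flux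
= invariance under `U_k ↦ −U_k`.  Claim: its first invariant excitation satisfies `−log(λ₁/λ₀) ≥ ε₁ (2/β)^{1/3} − C (2/β)^{2/3}` for
`β ≥ β₀`.  The cheapest falsifier of every normalisation in this module (`β = 2/g₀²`, kinetic term `exp(−(β/4)|c − c'|²)`, magnetic
term `(β/8) Σ_{k,l} |c_k × c_l|²`, hence `H = g₀^{2/3} 𝔥`): numerically decidable by diagonalising the kernel in a character basis.
[cite: Luscher1983] [cite: SimonB1983DiscreteSpectrum, eq. (3) p. 211] [status: open] -/
@[conjecture] def FemtoGapOneSite : Prop :=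
  ∃ C β0 : ℝ, ∀ β : ℝ, β0 ≤ β →
    secondValue su2Rep 1 β ≤
      Real.exp (-(luscherEps1 * bareLambda β - C * bareLambda β ^ 2) / (1 : ℕ)) * topValue su2Rep 1 β

/-- The one-site leaf is the `L = 1` instance of the fixed-lattice leaf. [folklore] -/
theorem femtoGapOneSite_of_fixedLattice (h : FemtoGapFixedLattice) : FemtoGapOneSite := h 1

/-- In the window the running parameter is pinned: `lam ≤ λ ≤ 2 lam`. [folklore] -/
theorem luscherLambda_mem_of_window {lam β : ℝ} {L : ℕ} (h : InFemtoWindow lam β L) :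
    lam ≤ luscherLambda β L ∧ luscherLambda β L ≤ 2 * lam := ⟨h.2.1, h.2.2⟩

/-- **SEAM (proved): `LuscherSimonGap → FemtoGapOfRecord → FemtoGapSU2`.**  With `0 < ε₁` (the tree's named fact: discrete spectrum and
simple ground state of `𝔥`), shrink the level so that `C λ² ≤ ε₁ λ / 2` on the window; then `ε₁ λ − C λ² ≥ ε₁ lam / 2 =: c > 0`. -/
theorem femtoGapSU2_of_ofRecord (hLS : LuscherSimonGap) (h : FemtoGapOfRecord) : FemtoGapSU2 := by
  have hε : 0 < luscherEps1 := hLS.2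
  obtain ⟨C, lam0, hlam0, hrec⟩ := h
  -- the positive part of `C` and the shrunk level
  set Cp : ℝ := max C 0 with hCp
  have hCp0 : 0 ≤ Cp := le_max_right _ _
  have hCle : C ≤ Cp := le_max_left _ _
  refine ⟨min lam0 (luscherEps1 / (4 * (Cp + 1))), lt_min hlam0 (by positivity), ?_⟩
  intro lam hlam hle
  have hle0 : lam ≤ lam0 := le_trans hle (min_le_left _ _)
  have hle1 : lam ≤ luscherEps1 / (4 * (Cp + 1)) := le_trans hle (min_le_right _ _)
  obtain ⟨L0, hL⟩ := hrec lam hlam hle0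
  refine ⟨luscherEps1 * lam / 2, by positivity, L0, ?_⟩
  intro L _ hL0 β hW
  have hmain := hL L hL0 β hW
  obtain ⟨hlo, hhi⟩ := luscherLambda_mem_of_window hW
  set l : ℝ := luscherLambda β L with hl
  have hlpos : 0 < l := lt_of_lt_of_le hlam hlo
  -- `C l² ≤ Cp l² ≤ Cp (2 lam) l ≤ (ε₁/2) l`
  have h1 : C * l ^ 2 ≤ Cp * l ^ 2 := mul_le_mul_of_nonneg_right hCle (by positivity)
  have h2 : Cp * l ^ 2 ≤ Cp * (2 * lam) * l := by
    have : l ^ 2 = l * l := sq l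
    rw [this, ← mul_assoc]
    exact mul_le_mul_of_nonneg_right (mul_le_mul_of_nonneg_left hhi hCp0) hlpos.le
  have h3 : Cp * (2 * lam) ≤ luscherEps1 / 2 := by
    have hC1 : 0 < Cp + 1 := by positivity
    calc Cp * (2 * lam) ≤ Cp * (2 * (luscherEps1 / (4 * (Cp + 1)))) := by
            exact mul_le_mul_of_nonneg_left (by linarith) hCp0
      _ = (Cp / (Cp + 1)) * (luscherEps1 / 2) := by field_simp; ring
      _ ≤ 1 * (luscherEps1 / 2) := by
            refine mul_le_mul_of_nonneg_right ?_ (by positivity)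
            rw [div_le_one hC1]; linarith
      _ = luscherEps1 / 2 := one_mul _
  have h4 : C * l ^ 2 ≤ luscherEps1 / 2 * l :=
    le_trans h1 (le_trans h2 (mul_le_mul_of_nonneg_right h3 hlpos.le))
  have hz : luscherEps1 * lam / 2 ≤ zLower C β L := by
    have : zLower C β L = luscherEps1 * l - C * l ^ 2 := rfl
    rw [this]
    have : luscherEps1 * lam ≤ luscherEps1 * l := mul_le_mul_of_nonneg_left hlo hε.le
    linarith
  -- monotonicity of `exp` and `0 ≤ λ₀`
  have hLpos : 0 < (L : ℝ) := Nat.cast_pos.mpr (Nat.pos_of_ne_zero (NeZero.ne L))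
  have hexp : Real.exp (-(zLower C β L) / L) ≤ Real.exp (-(luscherEps1 * lam / 2) / L) := by
    apply Real.exp_le_exp.mpr
    rw [div_le_div_iff_of_pos_right hLpos]
    linarith
  exact le_trans hmain (mul_le_mul_of_nonneg_right hexp (topValue_nonneg su2Rep L β))

end Summit.QuantumFields.YangMills.Theorems.FemtoTransferGap

end
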